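import Summits.Ventures.MM22.Rank333.ProfileCertBasics
import HarnessLib

/-!
# MM22 venture — PROFILE-CERT kernel replay: validity hypotheses, leaf rules, forced assignments

HONEST FRAMING (cell `pub-mm22`, seat p1 g5; V4-MENU item (0′) «kernel replay of the whole-root PROFILE-CERT»).
Checker PLUMBING with soundness theorems, written from the FROZEN format specification
`HOME/pub-mm22-p2/pcert/PROFILE-CERT-v1-frozen-20260822T2120Z.md` (sha256 59fc6c87…) only. The end declaration of the
chain (`ProfileCertGlue.rankGe21F2_of_pieces`) is an IMPLICATION whose antecedents are Wang's `Cert 3 3 3 [] 20`, a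
certified orbit table (Wang's printed values and the cell's 8 LP/LPDFS lifts), a passing singleton check and the
`NoExt` statement that the (not yet landed) data files assemble to. NOTHING here proves a bound on `R_𝔽₂(⟨3,3,3⟩)`;
no summit claim.

This file: `VHyp0`/`SymOK`/`VHyp`/`NoExt`/`RefsOK`, the rules C1/C3/C4, and the forced assignments P±.
-/

set_option autoImplicit false

namespace Summit.Ventures.MM22.ProfileCert

section Rules0
open Finset
/-! ## validity hypotheses, extensions -/

variable (rt : RT) (N : ℕ) (V : Finset ℕ → Prop)

/-- What the soundness theorem assumes about «valid» sets. -/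
structure VHyp0 : Prop where
  card : ∀ M, V M → M.card = N
  sub : ∀ M, V M → M ⊆ forms
  rows : ∀ M, V M → ∀ i, (M.filter fun f => (rt.get i).mask.testBit f = true).card ≤ (rt.get i).cap

/-- Invariance of «valid» under every listed-generator action with inverse witnesses (needed only for S-nodes). -/
def SymOK (V : Finset ℕ → Prop) : Prop := ∀ mp : MapW, mp.invOK = true → ∀ M, V M → V (M.image mp.sigma)

/-- Invariance of «valid» under the LISTED generators only (what an S-node actually uses; for sub-instances the listed
generators are those fixing the instance). -/
def SymOKL (V : Finset ℕ → Prop) (l : List MapW) : Prop :=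
  ∀ mp ∈ l, mp.invOK = true → ∀ M, V M → V (M.image mp.sigma)

/-- Full invariance gives invariance under any list. -/
theorem SymOK.symOKL {V : Finset ℕ → Prop} (h : SymOK V) (l : List MapW) : SymOKL V l := fun mp _ => h mp

/-- Monotonicity of `SymOKL` in the list. -/
theorem SymOKL.mono {V : Finset ℕ → Prop} {l l' : List MapW} (h : SymOKL V l) (hsub : ∀ mp ∈ l', mp ∈ l) : SymOKL V l' :=
  fun mp hmp => h mp (hsub mp hmp)

/-- The full hypotheses (with symmetry), as used for certificates WITH S-nodes. -/
structure VHyp : Prop extends VHyp0 rt N V where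
  sym : SymOK V

/-- No valid set extends the state. -/
def NoExt (s : St) : Prop := ∀ M, V M → s.Ext M → False

/-- The referenced chunks are closed. -/
def RefsOK (refs : List Entry) : Prop :=
  ∀ (k : ℕ) (e : Entry), refs[k]? = some e → NoExt V ⟨e.inL, e.out, e.inL.length, e.nOut⟩

variable {rt N V}

section Basic
variable {s : St} {M : Finset ℕ}

/-- An extension contains the IN set. -/
theorem St.Ext.inSet_subset (hE : s.Ext M) : s.inSet ⊆ M :=
  fun f hf => hE.1 f (List.mem_toFinset.1 hf)

/-- A valid extension lies inside IN ∪ FREE. -/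
theorem ext_subset_union (hV : VHyp0 rt N V) (hM : V M) (hE : s.Ext M) : M ⊆ s.inSet ∪ s.freeSet := by
  intro f hf
  rw [Finset.mem_union, St.inSet, List.mem_toFinset, St.mem_freeSet]
  by_cases hi : f ∈ s.inL
  · exact Or.inl hi
  · exact Or.inr ⟨hV.sub M hM hf, hi, hE.2 f hf⟩

/-- Inside `U`: `inU ≤ #(M ∩ U)`. -/
theorem inU_le_card (hW : s.WF) (hE : s.Ext M) (r : Row) :
    s.inU r ≤ (M.filter fun f => r.mask.testBit f = true).card := by
  rw [St.inU_eq hW]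
  exact Finset.card_le_card (Finset.filter_subset_filter _ hE.inSet_subset)

/-- Outside `U`: `#(M \ U) ≤ (nIn − inU) + avail`. -/
theorem card_out_le (hV : VHyp0 rt N V) (hW : s.WF) (hM : V M) (hE : s.Ext M) (r : Row) :
    (M.filter fun f => ¬ r.mask.testBit f = true).card ≤ (s.nIn - s.inU r) + s.avail r := by
  have hsub : (M.filter fun f => ¬ r.mask.testBit f = true) ⊆
      (s.inSet.filter fun f => ¬ r.mask.testBit f = true) ∪ (s.freeSet.filter fun f => ¬ r.mask.testBit f = true) := by
    rw [← Finset.filter_union]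
    exact Finset.filter_subset_filter _ (ext_subset_union hV hM hE)
  refine (Finset.card_le_card hsub).trans ((Finset.card_union_le _ _).trans ?_)
  have h1 : (s.inSet.filter fun f => ¬ r.mask.testBit f = true).card = s.nIn - s.inU r := by
    have := Finset.card_filter_add_card_filter_not (s := s.inSet) (fun f => r.mask.testBit f = true)
    rw [← St.inU_eq hW, St.inSet_card hW] at this
    omega
  have h2 : (s.freeSet.filter fun f => ¬ r.mask.testBit f = true).card = s.avail r := by
    have := Finset.card_filter_add_card_filter_not (s := s.freeSet) (fun f => r.mask.testBit f = true)
    rw [← St.freeU_eq hW, ← St.nFree_eq hW] at this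
    rw [St.avail]; omega
  omega

/-- `N − cap ≤ #(M \ U)` for valid `M`. -/
theorem sub_cap_le_card_out (hV : VHyp0 rt N V) (hM : V M) (i : ℕ) :
    N - (rt.get i).cap ≤ (M.filter fun f => ¬ (rt.get i).mask.testBit f = true).card := by
  have h1 := hV.rows M hM i
  have h2 := Finset.card_filter_add_card_filter_not (s := M) (fun f => (rt.get i).mask.testBit f = true)
  rw [hV.card M hM] at h2
  omega

end Basic

/-! ## well-formedness of the state transitions -/

section WFlemmas
variable {s : St}

/-- Setting a FREE form IN keeps the state well formed. -/
theorem St.WF.setIn (hW : s.WF) {f : ℕ} (hf : s.free f = true) : (s.setIn f).WF := by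
  obtain ⟨hfo, hfi, hfout⟩ := St.free_spec.1 hf
  refine ⟨?_, ?_, ?_, ?_, ?_, ?_⟩
  · exact List.nodup_cons.2 ⟨hfi, hW.nodup⟩
  · intro g hg
    rcases List.mem_cons.1 hg with rfl | hg
    · exact hfo
    · exact hW.in_form g hg
  · intro g hg
    rcases List.mem_cons.1 hg with rfl | hg
    · exact hfout
    · exact hW.in_out g hg
  · exact hW.out_form
  · simp [St.setIn, hW.nIn_eq]
  · rw [St.setIn, hW.nOut_eq]; rfl

/-- The OUT mask after `setOut`. -/
theorem St.testBit_setOut_out (s : St) (f g : ℕ) :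
    (s.setOut f).out.testBit g = (s.out.testBit g || decide (f = g)) := by
  rw [St.setOut, Nat.testBit_or, Nat.testBit_two_pow]

/-- Setting a FREE form OUT keeps the state well formed. -/
theorem St.WF.setOut (hW : s.WF) {f : ℕ} (hf : s.free f = true) : (s.setOut f).WF := by
  obtain ⟨hfo, hfi, hfout⟩ := St.free_spec.1 hf
  refine ⟨hW.nodup, hW.in_form, ?_, ?_, hW.nIn_eq, ?_⟩
  · intro g hg
    rw [St.testBit_setOut_out, hW.in_out g hg, Bool.false_or, decide_eq_false_iff_not]
    rintro rfl; exact hfi hg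
  · intro g hg
    rw [St.testBit_setOut_out, Bool.or_eq_true, decide_eq_true_eq] at hg
    rcases hg with hg | rfl
    · exact hW.out_form g hg
    · exact hfo
  · have hset : (s.setOut f).outSet = insert f s.outSet := by
      ext g
      rw [St.outSet, Finset.mem_filter, St.testBit_setOut_out, Finset.mem_insert, St.outSet, Finset.mem_filter,
        Bool.or_eq_true, decide_eq_true_eq]
      constructor
      · rintro ⟨hg, h | rfl⟩
        · exact Or.inr ⟨hg, h⟩
        · exact Or.inl rfl
      · rintro (rfl | ⟨hg, h⟩)
        · exact ⟨hfo, Or.inr rfl⟩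
        · exact ⟨hg, Or.inl h⟩
    have hnot : f ∉ s.outSet := by
      rw [St.outSet, Finset.mem_filter, hfout]; simp
    show s.nOut + 1 = _
    rw [hset, Finset.card_insert_of_notMem hnot, hW.nOut_eq]

/-- `free` is antitone along `setOut`. -/
theorem St.free_setOut {f g : ℕ} (h : (s.setOut f).free g = true) : s.free g = true ∧ g ≠ f := by
  rw [St.free_spec] at h ⊢
  rw [St.testBit_setOut_out, Bool.or_eq_false_iff, decide_eq_false_iff_not] at h
  exact ⟨⟨h.1, h.2.1, h.2.2.1⟩, fun e => h.2.2.2 e.symm⟩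

/-- Setting a duplicate-free list of FREE forms OUT keeps the state well formed. -/
theorem St.WF.setOutL (hW : s.WF) : ∀ (l : List ℕ), (∀ f ∈ l, s.free f = true) → l.Nodup → (s.setOutL l).WF := by
  intro l
  induction l generalizing s with
  | nil => intro _ _; exact hW
  | cons f fs ih =>
    intro hfree hnd
    rw [St.setOutL]
    refine ih (hW.setOut (hfree f (by simp))) (fun g hg => ?_) (List.nodup_cons.1 hnd).2
    have hgf : g ≠ f := fun e => (List.nodup_cons.1 hnd).1 (e ▸ hg)
    rw [St.free_spec]
    obtain ⟨h1, h2, h3⟩ := St.free_spec.1 (hfree g (List.mem_cons_of_mem f hg))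
    refine ⟨h1, h2, ?_⟩
    rw [St.testBit_setOut_out, h3, Bool.false_or, decide_eq_false_iff_not]
    exact fun e => hgf e.symm

end WFlemmas

/-! ## extension transfer along the state transitions -/

section ExtLemmas
variable {s : St} {M : Finset ℕ}

/-- An extension containing `f` extends `setIn f`. -/
theorem St.Ext.setIn_of_mem (hE : s.Ext M) {f : ℕ} (hf : f ∈ M) : (s.setIn f).Ext M :=
  ⟨fun g hg => by rcases List.mem_cons.1 hg with rfl | hg; exacts [hf, hE.1 g hg], hE.2⟩

/-- An extension avoiding `f` extends `setOut f`. -/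
theorem St.Ext.setOut_of_not_mem (hE : s.Ext M) {f : ℕ} (hf : f ∉ M) : (s.setOut f).Ext M :=
  ⟨hE.1, fun g hg => by
    rw [St.testBit_setOut_out, hE.2 g hg, Bool.false_or, decide_eq_false_iff_not]
    rintro rfl; exact hf hg⟩

/-- An extension avoiding a list extends `setOutL` of it. -/
theorem St.Ext.setOutL_of_disjoint (hE : s.Ext M) : ∀ (l : List ℕ), (∀ f ∈ l, f ∉ M) → (s.setOutL l).Ext M := by
  intro l
  induction l generalizing s with
  | nil => intro _; exact hE
  | cons f fs ih =>
    intro hl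
    exact ih (hE.setOut_of_not_mem (hl f (by simp))) (fun g hg => hl g (List.mem_cons_of_mem f hg))

/-- Extensions of `setIn f` are extensions containing `f`. -/
theorem St.Ext.of_setIn {f : ℕ} (hE : (s.setIn f).Ext M) : s.Ext M ∧ f ∈ M :=
  ⟨⟨fun g hg => hE.1 g (List.mem_cons_of_mem f hg), hE.2⟩, hE.1 f (by simp [St.setIn])⟩

/-- Extensions of `setOut f` are extensions avoiding `f`. -/
theorem St.Ext.of_setOut {f : ℕ} (hE : (s.setOut f).Ext M) : s.Ext M ∧ f ∉ M := by
  refine ⟨⟨hE.1, fun g hg => ?_⟩, fun hf => ?_⟩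
  · have := hE.2 g hg
    rw [St.testBit_setOut_out, Bool.or_eq_false_iff] at this
    exact this.1
  · have := hE.2 f hf
    rw [St.testBit_setOut_out, Bool.or_eq_false_iff] at this
    simp at this

end ExtLemmas

/-! ## the rules -/

section Rules
variable (hV : VHyp0 rt N V) {s : St} (hW : s.WF)
include hV hW

/-- Rule C1: a row already over its cap on IN. -/
theorem sound_c1 {i : ℕ} (h : (rt.get i).cap < s.inU (rt.get i)) : NoExt V s := fun M hM hE =>
  absurd ((inU_le_card hW hE (rt.get i)).trans (hV.rows M hM i)) (not_le.2 h)

/-- Rule C3: not enough forms available outside the row. -/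
theorem sound_c3 {i : ℕ} (h : (s.nIn - s.inU (rt.get i)) + s.avail (rt.get i) < N - (rt.get i).cap) :
    NoExt V s := fun _ hM hE =>
  absurd ((sub_cap_le_card_out hV hM i).trans (card_out_le hV hW hM hE (rt.get i))) (not_le.2 h)

/-- Rule C4: the counts cannot reach `N`. -/
theorem sound_c4 (h : s.nIn + s.nFree < N ∨ N < s.nIn) : NoExt V s := fun M hM hE => by
  rcases h with h | h
  · have := (Finset.card_le_card (ext_subset_union hV hM hE)).trans (Finset.card_union_le _ _)
    rw [St.inSet_card hW, ← St.nFree_eq hW, hV.card M hM] at this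
    omega
  · have := Finset.card_le_card hE.inSet_subset
    rw [St.inSet_card hW, hV.card M hM] at this
    omega

/-- `P f − rid`: a FREE `f ∈ U` with `cap(U) ≤ inU` is in no valid extension. -/
theorem forced_out {i f : ℕ} (hfU : (rt.get i).mask.testBit f = true) (hf : s.free f = true)
    (h : (rt.get i).cap ≤ s.inU (rt.get i)) {M : Finset ℕ} (hM : V M) (hE : s.Ext M) : f ∉ M := by
  intro hfM
  obtain ⟨_, hfi, _⟩ := St.free_spec.1 hf
  have hsub : insert f (s.inSet.filter fun g => (rt.get i).mask.testBit g = true) ⊆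
      M.filter fun g => (rt.get i).mask.testBit g = true := by
    intro g hg
    rcases Finset.mem_insert.1 hg with rfl | hg
    · exact Finset.mem_filter.2 ⟨hfM, hfU⟩
    · exact Finset.filter_subset_filter _ hE.inSet_subset hg
  have hnot : f ∉ s.inSet.filter fun g => (rt.get i).mask.testBit g = true :=
    fun h' => hfi (List.mem_toFinset.1 (Finset.mem_filter.1 h').1)
  have := Finset.card_le_card hsub
  rw [Finset.card_insert_of_notMem hnot, ← St.inU_eq hW] at this
  have := hV.rows M hM i
  omega

/-- `P f + rid`: a FREE `f ∉ U` with `(nIn − inU) + avail ≤ N − cap` is in every valid extension. -/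
theorem forced_in {i f : ℕ} (hfU : (rt.get i).mask.testBit f = false) (hf : s.free f = true)
    (h : (s.nIn - s.inU (rt.get i)) + s.avail (rt.get i) ≤ N - (rt.get i).cap) {M : Finset ℕ} (hM : V M)
    (hE : s.Ext M) : f ∈ M := by
  by_contra hfM
  -- M \ U ⊆ (IN \ U) ∪ (FREE \ U \ {f})
  have hsub : (M.filter fun g => ¬ (rt.get i).mask.testBit g = true) ⊆
      (s.inSet.filter fun g => ¬ (rt.get i).mask.testBit g = true) ∪
      ((s.freeSet.filter fun g => ¬ (rt.get i).mask.testBit g = true).erase f) := by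
    intro g hg
    obtain ⟨hgM, hgU⟩ := Finset.mem_filter.1 hg
    rcases Finset.mem_union.1 (ext_subset_union hV hM hE hgM) with hgi | hgf
    · exact Finset.mem_union.2 (Or.inl (Finset.mem_filter.2 ⟨hgi, hgU⟩))
    · refine Finset.mem_union.2 (Or.inr (Finset.mem_erase.2 ⟨?_, Finset.mem_filter.2 ⟨hgf, hgU⟩⟩))
      rintro rfl; exact hfM hgM
  have hfmem : f ∈ s.freeSet.filter fun g => ¬ (rt.get i).mask.testBit g = true :=
    Finset.mem_filter.2 ⟨St.free_iff.1 hf, by simp [hfU]⟩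
  have hc := (Finset.card_le_card hsub).trans (Finset.card_union_le _ _)
  rw [Finset.card_erase_of_mem hfmem] at hc
  have h1 : (s.inSet.filter fun g => ¬ (rt.get i).mask.testBit g = true).card = s.nIn - s.inU (rt.get i) := by
    have := Finset.card_filter_add_card_filter_not (s := s.inSet) (fun g => (rt.get i).mask.testBit g = true)
    rw [← St.inU_eq hW, St.inSet_card hW] at this
    omega
  have h2 : (s.freeSet.filter fun g => ¬ (rt.get i).mask.testBit g = true).card = s.avail (rt.get i) := by
    have := Finset.card_filter_add_card_filter_not (s := s.freeSet) (fun g => (rt.get i).mask.testBit g = true)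
    rw [← St.freeU_eq hW, ← St.nFree_eq hW] at this
    rw [St.avail]; omega
  have hpos : 0 < (s.freeSet.filter fun g => ¬ (rt.get i).mask.testBit g = true).card :=
    Finset.card_pos.2 ⟨f, hfmem⟩
  have h3 := sub_cap_le_card_out hV hM i
  omega

/-- `P f − N`: with `N ≤ nIn` no FREE form is in a valid extension. -/
theorem forced_out_N {f : ℕ} (hf : s.free f = true) (h : N ≤ s.nIn) {M : Finset ℕ} (hM : V M) (hE : s.Ext M) :
    f ∉ M := by
  intro hfM
  obtain ⟨_, hfi, _⟩ := St.free_spec.1 hf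
  have hnot : f ∉ s.inSet := fun h' => hfi (List.mem_toFinset.1 h')
  have := Finset.card_le_card (Finset.insert_subset hfM hE.inSet_subset)
  rw [Finset.card_insert_of_notMem hnot, St.inSet_card hW, hV.card M hM] at this
  omega

/-- `P f + N`: with `nIn + nFree ≤ N` every FREE form is in every valid extension. -/
theorem forced_in_N {f : ℕ} (hf : s.free f = true) (h : s.nIn + s.nFree ≤ N) {M : Finset ℕ} (hM : V M)
    (hE : s.Ext M) : f ∈ M := by
  by_contra hfM
  have hsub : M ⊆ (s.inSet ∪ s.freeSet).erase f := fun g hg =>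
    Finset.mem_erase.2 ⟨by rintro rfl; exact hfM hg, ext_subset_union hV hM hE hg⟩
  have hfmem : f ∈ s.inSet ∪ s.freeSet := Finset.mem_union.2 (Or.inr (St.free_iff.1 hf))
  have := (Finset.card_le_card hsub)
  rw [Finset.card_erase_of_mem hfmem] at this
  have hu := Finset.card_union_le s.inSet s.freeSet
  rw [St.inSet_card hW, ← St.nFree_eq hW] at hu
  have hpos : 0 < (s.inSet ∪ s.freeSet).card := Finset.card_pos.2 ⟨f, hfmem⟩
  rw [hV.card M hM] at this
  omega

end Rules


end Rules0

end Summit.Ventures.MM22.ProfileCert
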